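import Summits.ResolutionOfSingularities.ResolutionOfSingularities.Theorems.WeightedInvariantIota3SuccRatioOfNonreachK
import HarnessLib

/-!
# Tools for (NONREACH-K): the translate only matters modulo `𝔪`, and the `τ = 0` witness violates the transversal weight condition
# (door `HypersurfaceCentreConstruction`, stmt-ResolutionOfSingularities-19897, stub `stub_keyRungGrHomLE_three`)

Helper for `stub_keyRungGrHomLE_three` (def-free, `--supports 19897`): two small inputs for the residual (NONREACH-K) of this hand's sharpest gap list
`keyRungGrHomLE_three_of_tieDescent_point_nonreachK` (…KeyRungThreeOfDropCurveNonreachK; SIGMA-ISO.md rev 3 §2).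

* **`Iota3.mem_ratContactFiltration_translate_iff_of_sub_mem`** — at the ratio `(q+ρ)/q ≤ 2` the translate `W − c'·T` only matters modulo `𝔪`:
  if `c' − c'' ∈ 𝔪` (and `T ∈ 𝔪`, `ρ ≤ q`) then `g ∈ RC(W − c'T; q+ρ, q; n) ↔ g ∈ RC(W − c''T; q+ρ, q; n)` (R9 `ratContactFiltration_congr_mod_pow`
  with `N = 2`); in particular (**`Iota3.mem_ratContactFiltration_translate_iff_of_mem`**) a translate with `c' ∈ 𝔪` is as good as `c' = 0`.
  So (NONREACH-K) splits into the STRAIGHT case `c' = 0` and the translates by residue representatives of the UNITS of `κ(𝔫)`.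
* **`Iota3.witness_violates_transversal_weight`** — the arithmetic of R9's «witness lands low» in the frame `(x, y, z)` of `S`: for an exponent
  `(j, i, k)` of `x^j y^i z^k` with `i < ν`, the AQS face condition `r·(ν−i) ≤ q·j` and the `τ = 0` witness inequality `q·j + k < (r+1)·(ν−i)`
  (with `q ≥ 2`) give `q·j + q·k + (r+q)·i < (r+q)·ν` — the witness monomial lies BELOW the weight `(x, y, z) ↦ (q, r+q, q)`, level `(r+q)ν`, which is
  the pull-back to `S` of a slope-`(q+ρ)/q` reach along `W` at the pinned successor (`x = T·X`, `y = T^b W`: `q·j' + q·k ≥ (q+ρ)(ν−i)` with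
  `j' = j − b(ν−i)`, `r = qb + ρ`).

[OURS · L1 W4.3 · kernel lemmas; AI work, weaker than expert review; nothing here is a statement of the manuscript under review
(Hironaka 2017, [claim: Hironaka2017, status: under-review]).]

## References

* H. Hironaka, *Characteristic polyhedra of singularities*, J. Math. Kyoto Univ. 7 (1967), §3. [Hironaka1967]
* res-L1-w43-idea-2, Sketch-R9 §5 (`witness_lands_low`), §11 (OURS; tree …SuccessorRatioBoundContact / …Stability).
-/

noncomputable section

set_option linter.dupNamespace false -- mandated namespace of this single-conjunct summit

open IsLocalRing Literature.AlgebraicGeometry.Resolution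
open Summit.ResolutionOfSingularities.ResolutionOfSingularities.Theorems
open Summit.ResolutionOfSingularities.ResolutionOfSingularities.Cruxes.HypersurfaceCentreConstruction.LocalEngine.Iota3.RatContact

namespace Summit.ResolutionOfSingularities.ResolutionOfSingularities.Cruxes.HypersurfaceCentreConstruction.LocalEngine

namespace Iota3

/-! ## §1 The translate only matters modulo `𝔪` -/

/-- **At the ratio `(q+ρ)/q ≤ 2` the translate `W − c'·T` only matters modulo `𝔪`**: `c' − c'' ∈ 𝔪`, `T ∈ 𝔪`, `0 < q`, `ρ ≤ q` give
`g ∈ RC(W − c'T; q+ρ, q; n) ↔ g ∈ RC(W − c''T; q+ρ, q; n)`. [OURS · L1 W4.3] [cite: Hironaka1967, §3] -/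
theorem mem_ratContactFiltration_translate_iff_of_sub_mem {L : Type} [CommRing L] [IsLocalRing L] {T W c' c'' g : L} {q ρ : ℕ}
    (hT : T ∈ maximalIdeal L) (hq : 0 < q) (hρq : ρ ≤ q) (hc : c' - c'' ∈ maximalIdeal L) (n : ℕ) :
    g ∈ ratContactFiltration (W - c' * T) (q + ρ) q n ↔ g ∈ ratContactFiltration (W - c'' * T) (q + ρ) q n := by
  have hdiff : (W - c' * T) - (W - c'' * T) ∈ maximalIdeal L ^ 2 := by
    have h1 : (W - c' * T) - (W - c'' * T) = -((c' - c'') * T) := by ring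
    rw [h1, pow_two]
    exact Submodule.neg_mem _ (Ideal.mul_mem_mul hc hT)
  rw [ratContactFiltration_congr_mod_pow hq (show q + ρ ≤ q * 2 by omega) hdiff n]

/-- **A translate with `c' ∈ 𝔪` is as good as the straight member `W`.** [OURS · L1 W4.3] -/
theorem mem_ratContactFiltration_translate_iff_of_mem {L : Type} [CommRing L] [IsLocalRing L] {T W c' g : L} {q ρ : ℕ}
    (hT : T ∈ maximalIdeal L) (hq : 0 < q) (hρq : ρ ≤ q) (hc : c' ∈ maximalIdeal L) (n : ℕ) :
    g ∈ ratContactFiltration (W - c' * T) (q + ρ) q n ↔ g ∈ ratContactFiltration W (q + ρ) q n := by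
  have h := mem_ratContactFiltration_translate_iff_of_sub_mem (W := W) (g := g) (c'' := 0) hT hq hρq (by rw [sub_zero]; exact hc) n
  rwa [zero_mul, sub_zero] at h

/-- **(NONREACH-K) from the straight member and the unit translates**: if `g ∉ RC(W; q+ρ, q; n)` and `g ∉ RC(W − c'T; q+ρ, q; n)` for every UNIT `c'`,
then `g ∉ RC(W − c'T; q+ρ, q; n)` for every `c'`. [OURS · L1 W4.3] -/
theorem not_mem_ratContactFiltration_translate_of_straight_of_units {L : Type} [CommRing L] [IsLocalRing L] {T W g : L} {q ρ : ℕ}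
    (hT : T ∈ maximalIdeal L) (hq : 0 < q) (hρq : ρ ≤ q) (n : ℕ) (h0 : g ∉ ratContactFiltration W (q + ρ) q n)
    (hunit : ∀ c' : L, IsUnit c' → g ∉ ratContactFiltration (W - c' * T) (q + ρ) q n) :
    ∀ c' : L, g ∉ ratContactFiltration (W - c' * T) (q + ρ) q n := by
  intro c'
  by_cases hc : IsUnit c'
  · exact hunit c' hc
  · rw [mem_ratContactFiltration_translate_iff_of_mem hT hq hρq ((IsLocalRing.mem_maximalIdeal c').mpr hc) n]
    exact h0

/-! ## §2 The `τ = 0` witness violates the transversal weight condition -/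

/-- **«The witness lands low» in the frame of `S`**: for an exponent `(j, i, k)` of `x^j y^i z^k` with `i < ν`, the AQS face condition
`r·(ν − i) ≤ q·j`, the `τ = 0` witness inequality `q·j + k < (r+1)·(ν − i)` and `q ≥ 2` give `q·j + q·k + (r+q)·i < (r+q)·ν`: the witness monomial
violates the weight condition `(x, y, z) ↦ (q, r+q, q) ≥ (r+q)ν` that a slope-`(q+ρ)/q` reach along `W` at the pinned successor pulls back to.
[OURS · L1 W4.3 · R9 §5 in `S`-coordinates] -/
theorem witness_violates_transversal_weight {q r ν j i k : ℕ} (hq : 2 ≤ q) (hi : i < ν) (hface : r * (ν - i) ≤ q * j)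
    (hwit : q * j + k < (r + 1) * (ν - i)) : q * j + q * k + (r + q) * i < (r + q) * ν := by
  obtain ⟨m, hm⟩ : ∃ m, ν = i + m := ⟨ν - i, by omega⟩
  subst hm
  rw [Nat.add_sub_cancel_left] at hface hwit
  have hm1 : 1 ≤ m := by omega
  suffices h : q * j + q * k < (r + q) * m by nlinarith [h]
  by_contra h
  have h : (r + q) * m ≤ q * j + q * k := Nat.le_of_not_lt h
  have h1 : q * (q * j + k) < q * ((r + 1) * m) := Nat.mul_lt_mul_of_pos_left hwit (by omega)
  nlinarith [h, h1, hface, hq, hm1, Nat.mul_le_mul_right m hq]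

/-- The same in the chart coordinates of the pinned successor (`j' = j − b·(ν − i)`, `r = q·b + ρ`): the witness has
`q·j' + q·k < (q+ρ)·(ν − i)`, i.e. `(t⁻¹, z)`-value `< 1 + ρ/q` relative to `W` (R9's `witness_lands_low`, restated). [OURS · L1 W4.3] -/
theorem witness_lands_below_K {q b ρ ν j i k : ℕ} (hq : 2 ≤ q) (hi : i < ν) (hface : (q * b + ρ) * (ν - i) ≤ q * j)
    (hwit : q * j + k < (q * b + ρ + 1) * (ν - i)) (hbj : b * (ν - i) ≤ j) :
    q * (j - b * (ν - i)) + q * k < (q + ρ) * (ν - i) := by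
  have h := witness_violates_transversal_weight (r := q * b + ρ) hq hi hface hwit
  obtain ⟨m, hm⟩ : ∃ m, ν = i + m := ⟨ν - i, by omega⟩
  subst hm
  rw [Nat.add_sub_cancel_left] at hbj ⊢
  rw [Nat.add_sub_cancel_left] at hface hwit
  obtain ⟨j', rfl⟩ : ∃ j', j = b * m + j' := ⟨j - b * m, by omega⟩
  rw [Nat.add_sub_cancel_left]
  nlinarith [h, hface, hwit, hq]

end Iota3

end Summit.ResolutionOfSingularities.ResolutionOfSingularities.Cruxes.HypersurfaceCentreConstruction.LocalEngine

end
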